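import Literature.NumberTheory.EllipticCurves.DeuringSupersingularReduction
import Literature.NumberTheory.EllipticCurves.SupersingularCharTwoProofs
import Literature.NumberTheory.EllipticCurves.SupersingularJInvariantFiniteFieldProofs
import Literature.NumberTheory.EllipticCurves.ReductionAtJInvariantProofs
import Literature.NumberTheory.EllipticCurves.ComplexMultiplicationDeuringReductionHoldsProofs
import Literature.NumberTheory.EllipticCurves.IsogenyHasCMIffJMemProofs
import Literature.NumberTheory.EllipticCurves.IwasawaSelmerOrdinaryProofs
import HarnessLib

/-!
# Deuring's criterion, supersingular half — proofs: the maximal-order engine over `ℚ` at every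
# prime, and the case `p = 2` of the named fact over every number field

`Proofs` file (theorems only, no definitions, no named facts), topic `NumberTheory/EllipticCurves`;
sibling of `DeuringSupersingularReduction`, whose named fact
`deuring_not_hasUnitRootAt_of_hasCM_of_not_cmSplit` (Lang, *Elliptic Functions*, Ch. 13 §4
Thm. 12, supersingular half: a CM curve `E/ℚ`, a prime `p` that does not split in the CM field,
a number field `F` and a place `w ∣ p` of good reduction of `E_F` ⟹ `¬ HasUnitRootAt w`) this file
starts to discharge, along the `j`-INVARIANT ROUTE (HOME/b2b-bsdres-lit-bst/BST-BCST.md §14.4):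
the reduction `Ẽ_w` has `j(Ẽ_w) = j(E) mod p ∈ 𝔽_p` (`ReductionAtJInvariantProofs`), and
supersingularity over a finite field depends only on `(j̃, p)`
(`SupersingularJInvariantFiniteFieldProofs`), so the place-level statement reduces to curves
over `𝔽_p` — reductions of globally minimal `ℚ`-models (§1) — or, when `j̃ = 0` in characteristic
`2`, to `SupersingularCharTwoProofs`.

* §1 **The maximal-order engine over `ℚ`, every prime.** For a globally minimal `W/ℚ` with
  `j(W) ∈ maximalCMJInvariants` (CM by `𝓞_K = ℤ[ω_d]`, `d = cmDiscr j(W)`, `ω_d² − dω_d + c = 0`,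
  `4c = d² − d`) and a good prime `p`: the reduction `ω̄ = r(ι₀ ω_d)` of the complex
  multiplication (Cox §14.B `ι₀ : ℤ[ω_d] ≅ End_{ℚ̄}(E)`, `Cox2013_exists_ringEquiv_cmRing_geomEndRing_holds`;
  Silverman *AT* II.4.4 `r : End_{ℚ̄}(E) → End_{𝔽̄_p}(Ē)`, `Silverman1994_exists_reduction_ringHom_geomEndRing_holds`)
  satisfies the same quadratic relation on `Ē(𝔽̄_p)`, whence by the finite-field criterion
  (`SupersingularDeuringCriterionFiniteFieldProofs.char_dvd_trace_of_forall_zmod_ne_zero`):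
  **`X² − dX + c` rootless mod `p` ⟹ `p ∣ a_p(W)`**
  (`natCast_dvd_frobeniusTrace_of_mem_maximalCMJInvariants_of_forall_ne_zero`); in particular
  **`d` a non-square mod `p` ⟹ `p ∣ a_p(W)`** (`…_of_not_isSquare`, every `p`; the tree's
  `natCast_dvd_frobeniusTrace_iff_not_isSquare_of_reduction` needs `p` odd, `p ∤ D`) and
  **`d ≡ 5 (mod 8)` ⟹ `2 ∣ a_2(W)`** (`two_dvd_frobeniusTrace_of_mem_maximalCMJInvariants_of_mod_eight`).
* §2 **The case `p = 2` of the named fact, over every number field**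
  (`deuring_not_hasUnitRootAt_of_hasCM_of_not_cmSplit_two`): for a CM curve `E/ℚ` with `2`
  non-split in `K` (i.e. `d_K ≠ −7`, Deuring/BCST Rem. D: every CM `j` except `−3375, 16581375`),
  `j(E)` is an EVEN integer (the table `cmJInvariants`), so at a place `w ∣ 2` of good reduction
  `j(Ẽ_w) = 0` in characteristic `2` and `Ẽ_w` is supersingular (Silverman *AEC* Ex. 5.7), i.e.
  `2 ∣ #k_w + 1 − #Ẽ_w(k_w)`: `¬ HasUnitRootAt w`. No comparison curve and no endomorphism
  reduction at `w` are needed at `p = 2`.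

What remains for `deuring_not_hasUnitRootAt_of_hasCM_of_not_cmSplit_holds` (odd `p`): ramified
odd `p` (`j ≡ 1728 mod p`, comparison curve `y² = x³ − x`; `p = 3` by a point count over `𝔽₃`)
and inert odd `p` (§1 on a good globally minimal `ℚ`-model with the same `j`; the four non-maximal
`j` through their `ℚ`-isogenies to maximal ones), then `char_dvd_trace_iff_of_j_eq_intCast`.

## References

* [Lang1987] S. Lang, *Elliptic Functions*, 2nd ed., GTM 112 (1987), Ch. 13 §4 Thm. 12 (PDF
  p. 140) and its proof; Ch. 13 §2 Thm. 5(i).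
* [Cox2013] D. A. Cox, *Primes of the form x² + ny²*, 2nd ed. (2013), §14.B–C (Thm. 14.16).
* [SilvermanAdvancedTopics1994] J. H. Silverman, *Advanced Topics*, GTM 151 (1994),
  Prop. II.4.4, App. A §3.
* [SilvermanAEC2009] J. H. Silverman, *The Arithmetic of Elliptic Curves*, 2nd ed. (2009),
  Ex. 5.7, §V.4, App. C §11.
* [Deuring1941] M. Deuring, Abh. Math. Sem. Univ. Hamburg 14 (1941), 197–272.

## Design

`noncomputable section`, `open scoped Classical NumberField`. §1 in
`namespace Literature.NumberTheory.EllipticCurves` (next to `frobeniusTrace`, `reductionModPrime`);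
§2 states the `p = 2` case in exactly the binder shape of the named fact. Nothing is defined; the two
discharged facts of the tree enter through their `_holds` theorems, no named fact as a hypothesis.
-/

noncomputable section

open scoped Classical NumberField

open IsDedekindDomain NumberField WeierstrassCurve

namespace Literature.NumberTheory.EllipticCurves

/-! ## §1 The maximal-order engine over `ℚ`: `X² − dX + c` rootless mod `p` ⟹ `p ∣ a_p` -/

/-- **Deuring for CM by a maximal order over `ℚ`, every prime, from the reduced complex
multiplication.** Let `W/ℚ` be globally minimal with `j(W) ∈ maximalCMJInvariants`,
`d = cmDiscr j(W)`, `4c = d² − d`, and let `p ∤ Δ_W`. If `X² − dX + c` has no root modulo `p`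
(`p` does not split in `ℚ(√d)`: inert, or `p = 2` with `d ≡ 5 mod 8`), then `p ∣ a_p(W)`. Proof:
`ω̄ = r(ι₀ ω_d) ∈ End_{𝔽̄_p}(Ē)` satisfies `ω̄² − dω̄ + c = 0` (Cox §14.B, Silverman *AT* II.4.4 —
the tree's discharged `Cox2013_…_holds`, `Silverman1994_…_holds`), and an additive endomorphism of
`Ē(𝔽̄_p)` with a rootless quadratic relation forces supersingularity (Lang Ch. 13 §4 Thm. 12 via
§2 Thm. 5(i): `char_dvd_trace_of_forall_zmod_ne_zero`).
[cite: Lang1987, Ch. 13 §4 Thm. 12 (PDF p. 140)] [cite: Cox2013, Thm. 14.16, proof (§14.C)]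
[cite: SilvermanAdvancedTopics1994, Prop. II.4.4] -/
theorem natCast_dvd_frobeniusTrace_of_mem_maximalCMJInvariants_of_forall_ne_zero
    (W : WeierstrassCurve ℚ) [W.IsElliptic] [W.IsGloballyMinimal]
    (hj : W.j ∈ maximalCMJInvariants) (p : ℕ) [Fact p.Prime]
    (hΔ : ¬ (p : ℤ) ∣ minimalDiscriminantInt W) {c : ℤ}
    (hc : cmDiscr W.j * (cmDiscr W.j - 1) = 4 * c)
    (hroot : ∀ x : ZMod p, x * x - (cmDiscr W.j : ZMod p) * x + (c : ZMod p) ≠ 0) :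
    (p : ℤ) ∣ W.frobeniusTrace p := by
  haveI : (reductionModPrime W p).IsElliptic := isElliptic_reductionModPrime W hΔ
  obtain ⟨hdneg, -⟩ := neg_and_exists_of_mem_cmDiscrs (cmDiscr_mem_cmDiscrs hj)
  obtain ⟨ι₀, -⟩ := Cox2013_exists_ringEquiv_cmRing_geomEndRing_holds W hj
  obtain ⟨r, -, -⟩ := Silverman1994_exists_reduction_ringHom_geomEndRing_holds W p hΔ
  obtain ⟨ωd, hωdC⟩ : ∃ ωd : cmRing (cmDiscr W.j), (ωd : ℂ) = cmGen (cmDiscr W.j) :=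
    ⟨⟨_, cmGen_mem_cmRing _⟩, rfl⟩
  have hωd2 : ωd * ωd - (cmDiscr W.j : cmRing (cmDiscr W.j)) * ωd +
      (c : cmRing (cmDiscr W.j)) = 0 := by
    apply Subtype.ext
    push_cast
    rw [hωdC]
    linear_combination cmGen_sq hdneg.le hc
  set φ : AddMonoid.End (reductionModPrime W p).geomPoints :=
    ((r (ι₀ ωd) : (reductionModPrime W p).geomEndRing) :
      AddMonoid.End (reductionModPrime W p).geomPoints) with hφ
  have hrel : φ * φ - (cmDiscr W.j : AddMonoid.End (reductionModPrime W p).geomPoints) * φ +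
      (c : AddMonoid.End (reductionModPrime W p).geomPoints) = 0 := by
    have h := congrArg (fun z : cmRing (cmDiscr W.j) ↦ ((r (ι₀ z) :
      (reductionModPrime W p).geomEndRing) : AddMonoid.End (reductionModPrime W p).geomPoints)) hωd2
    simpa using h
  have hpt : ∀ Q : (reductionModPrime W p).geomPoints,
      φ (φ Q) - (cmDiscr W.j) • φ Q + c • Q = 0 := fun Q ↦ by
    have h := congrArg (fun f : AddMonoid.End (reductionModPrime W p).geomPoints ↦ f Q) hrel
    change φ (φ Q) - (cmDiscr W.j : AddMonoid.End (reductionModPrime W p).geomPoints) (φ Q) +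
      (c : AddMonoid.End (reductionModPrime W p).geomPoints) Q = 0 at h
    rwa [AddMonoid.End.intCast_apply, AddMonoid.End.intCast_apply] at h
  have h := (reductionModPrime W p).char_dvd_trace_of_forall_zmod_ne_zero p φ hpt hroot
  rw [Nat.card_zmod] at h
  rwa [frobeniusTrace_eq_sub_natCard_reductionModPrime]

/-- **Deuring, inert ⟹ supersingular, for CM by a maximal order over `ℚ`, every prime**: `W/ℚ`
globally minimal with `j(W) ∈ maximalCMJInvariants`, `d = cmDiscr j(W)`, `p ∤ Δ_W`, `d` a
non-square modulo `p` ⟹ `p ∣ a_p(W)` (for then `X² − dX + c`, `4c = d² − d`, has no root mod `p`: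
`(2x − d)² = d` at a root `x`). No parity hypothesis (at `p = 2` the premise is void).
[cite: Lang1987, Ch. 13 §4 Thm. 12 (PDF p. 140)] [cite: Cox2013, Thm. 14.16, proof (§14.C)] -/
theorem natCast_dvd_frobeniusTrace_of_mem_maximalCMJInvariants_of_not_isSquare
    (W : WeierstrassCurve ℚ) [W.IsElliptic] [W.IsGloballyMinimal]
    (hj : W.j ∈ maximalCMJInvariants) (p : ℕ) [Fact p.Prime]
    (hΔ : ¬ (p : ℤ) ∣ minimalDiscriminantInt W)
    (hns : ¬ IsSquare ((cmDiscr W.j : ℤ) : ZMod p)) :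
    (p : ℤ) ∣ W.frobeniusTrace p := by
  obtain ⟨-, c, hc⟩ := neg_and_exists_of_mem_cmDiscrs (cmDiscr_mem_cmDiscrs hj)
  refine natCast_dvd_frobeniusTrace_of_mem_maximalCMJInvariants_of_forall_ne_zero W hj p hΔ hc
    fun x hx ↦ hns ⟨2 * x - cmDiscr W.j, ?_⟩
  have hc' : (cmDiscr W.j : ZMod p) * ((cmDiscr W.j : ZMod p) - 1) = 4 * (c : ZMod p) := by
    exact_mod_cast congrArg (Int.cast : ℤ → ZMod p) hc
  linear_combination (-4 : ZMod p) * hx - hc'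

/-- **The inert prime `2` for CM by a maximal order over `ℚ`**: `W/ℚ` globally minimal with
`j(W) ∈ maximalCMJInvariants`, `d = cmDiscr j(W) ≡ 5 (mod 8)` (`2` inert in `ℚ(√d)`), `2 ∤ Δ_W`
⟹ `2 ∣ a_2(W)` (`X² − dX + c ≡ X² + X + 1` is rootless in `𝔽₂`).
[cite: Lang1987, Ch. 13 §4 Thm. 12 (PDF p. 140)] [cite: Cox2013, Thm. 14.16, proof (§14.C)] -/
theorem two_dvd_frobeniusTrace_of_mem_maximalCMJInvariants_of_mod_eight
    (W : WeierstrassCurve ℚ) [W.IsElliptic] [W.IsGloballyMinimal]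
    (hj : W.j ∈ maximalCMJInvariants) (hΔ : ¬ (2 : ℤ) ∣ minimalDiscriminantInt W)
    (h5 : cmDiscr W.j % 8 = 5) : (2 : ℤ) ∣ W.frobeniusTrace 2 := by
  obtain ⟨-, c, hc⟩ := neg_and_exists_of_mem_cmDiscrs (cmDiscr_mem_cmDiscrs hj)
  have hd2 : cmDiscr W.j % 2 = 1 := by omega
  have h4c : (cmDiscr W.j * cmDiscr W.j - cmDiscr W.j) % 8 = 4 := by
    rw [Int.sub_emod, Int.mul_emod, h5]
    norm_num
  have hc2 : c % 2 = 1 := by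
    have hc1 : cmDiscr W.j * cmDiscr W.j - cmDiscr W.j = 4 * c := by rw [← hc]; ring
    generalize hm : cmDiscr W.j * cmDiscr W.j - cmDiscr W.j = m at hc1 h4c
    omega
  have hdZ : ((cmDiscr W.j : ℤ) : ZMod 2) = 1 := by
    have h := ZMod.intCast_mod (cmDiscr W.j) 2
    rw [show (((2 : ℕ) : ℤ)) = 2 by norm_num, hd2] at h
    exact_mod_cast h.symm
  have hcZ : ((c : ℤ) : ZMod 2) = 1 := by
    have h := ZMod.intCast_mod c 2
    rw [show (((2 : ℕ) : ℤ)) = 2 by norm_num, hc2] at h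
    exact_mod_cast h.symm
  have h := natCast_dvd_frobeniusTrace_of_mem_maximalCMJInvariants_of_forall_ne_zero W hj 2
    (by exact_mod_cast hΔ) hc (by rw [hdZ, hcZ]; decide)
  exact_mod_cast h

end Literature.NumberTheory.EllipticCurves

/-! ## §2 The case `p = 2` of the named fact, over every number field -/

namespace Literature.NumberTheory.EllipticCurves

open Rank1Residual

/-- **A CM `j`-invariant over `ℚ` with `2` non-split in the CM field is an EVEN integer.** From the
table of the thirteen CM `j`-invariants (Silverman *AEC* App. C §11, *AT* App. A §3; the tree's
`cmJInvariants`, `hasCM_iff_j_mem_holds`): `2` splits in `K` iff `d_K ≡ 1 (mod 8)` iff `d_K = −7`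
(`j ∈ {−3375, 16581375}`, the two odd values); the other eleven are even.
[cite: SilvermanAEC2009, App. C §11, Examples 11.3.1–11.3.2] [cite: SilvermanAdvancedTopics1994, App. A §3] -/
theorem exists_j_eq_intCast_even_of_hasCM_of_not_cmSplit_two (E : WeierstrassCurve ℚ)
    [E.IsElliptic] (hCM : E.HasCM) (hns : ¬ CMSplit E 2) :
    ∃ n : ℤ, E.j = n ∧ (2 : ℤ) ∣ n := by
  have hj := (hasCM_iff_j_mem_holds E).mp hCM
  have hsplit7 : cmFieldDiscrOfJ E.j = -7 → CMSplit E 2 := fun hd ↦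
    ⟨by rw [hd]; norm_num, by rw [if_pos rfl, hd]; norm_num⟩
  simp only [cmJInvariants, Finset.mem_insert, Finset.mem_singleton] at hj
  rcases hj with h | h | h | h | h | h | h | h | h | h | h | h | h
  · exact ⟨0, by rw [h]; norm_num, by norm_num⟩
  · exact ⟨1728, by rw [h]; norm_num, by norm_num⟩
  · exact absurd (hsplit7 (by rw [h]; norm_num [cmFieldDiscrOfJ])) hns
  · exact ⟨8000, by rw [h]; norm_num, by norm_num⟩
  · exact ⟨-32768, by rw [h]; norm_num, by norm_num⟩
  · exact ⟨54000, by rw [h]; norm_num, by norm_num⟩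
  · exact ⟨287496, by rw [h]; norm_num, by norm_num⟩
  · exact ⟨-884736, by rw [h]; norm_num, by norm_num⟩
  · exact ⟨-12288000, by rw [h]; norm_num, by norm_num⟩
  · exact absurd (hsplit7 (by rw [h]; norm_num [cmFieldDiscrOfJ])) hns
  · exact ⟨-884736000, by rw [h]; norm_num, by norm_num⟩
  · exact ⟨-147197952000, by rw [h]; norm_num, by norm_num⟩
  · exact ⟨-262537412640768000, by rw [h]; norm_num, by norm_num⟩

/-- **Deuring's criterion (supersingular half) at `p = 2`, over every number field — the case
`p = 2` of `deuring_not_hasUnitRootAt_of_hasCM_of_not_cmSplit`, PROVED.** For an elliptic curve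
`E/ℚ` with complex multiplication and `2` non-split in the CM field (`¬ CMSplit E 2`), a number
field `F` and a finite place `w ∣ 2` of `F` at which `E_F` has good reduction, the unit-root
(ordinary) condition fails: `2 ∣ #k_w + 1 − #Ẽ_w(k_w)`. Proof along the `j`-invariant route:
`j(E)` is an even integer (`exists_j_eq_intCast_even_of_hasCM_of_not_cmSplit_two`), so
`j(Ẽ_w) = 0` in the residue field of characteristic `2` (`j_reductionAt_baseChange_eq_intCast`,
Silverman VII.§2), and a curve with `j = 0` in characteristic `2` is supersingular over every finite
field (`two_dvd_trace_of_j_eq_intCast_of_even`, Silverman Ex. 5.7 / §V.4). Lang, Ch. 13 §4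
Thm. 12: "`Ā` is supersingular if … `p` ramifies or remains prime in `k`", here `p = 2`.
[cite: Lang1987, Ch. 13 §4 Thm. 12 (PDF p. 140)] [cite: SilvermanAEC2009, Ex. 5.7 and VII.§2] -/
theorem deuring_not_hasUnitRootAt_of_hasCM_of_not_cmSplit_two :
    ∀ (E : WeierstrassCurve ℚ) [E.IsElliptic], E.HasCM → ¬ CMSplit E 2 →
      ∀ (F : Type) [Field F] [NumberField F] (w : HeightOneSpectrum (𝓞 F)),
        ((2 : ℕ) : 𝓞 F) ∈ w.asIdeal → (E.baseChange F).HasGoodReductionAt w →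
        ¬ (E.baseChange F).HasUnitRootAt w := by
  intro E _ hCM hns F _ _ w hw hgood hunit
  obtain ⟨n, hjn, hn2⟩ := exists_j_eq_intCast_even_of_hasCM_of_not_cmSplit_two E hCM hns
  haveI : ((E.baseChange F).reductionAt w).IsElliptic := isElliptic_reductionAt hgood
  have hjV : ((E.baseChange F).reductionAt w).j = n :=
    j_reductionAt_baseChange_eq_intCast E w hgood hjn
  have hchar : ringChar (IsLocalRing.ResidueField (w.adicCompletionIntegers F)) = 2 :=
    ringChar_residueField_eq w Nat.prime_two hw
  haveI : CharP (IsLocalRing.ResidueField (w.adicCompletionIntegers F)) 2 := ringChar.of_eq hchar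
  have h2 := ((E.baseChange F).reductionAt w).two_dvd_trace_of_j_eq_intCast_of_even hjV hn2
  refine (hasUnitRootAt_iff w (E.baseChange F)).mp hunit ?_
  rw [hchar]
  exact_mod_cast h2

end Literature.NumberTheory.EllipticCurves

end
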